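import Literature.AlgebraicGeometry.HodgeTheory.HodgeGenericPointsComeagreOfLociDichotomy
import Literature.AlgebraicGeometry.HodgeTheory.GriffithsHolomorphicHodgeSubbundles
import Literature.AlgebraicGeometry.HodgeTheory.AlgebraicMonodromyMumfordTate
import HarnessLib

/-!
# The non-Hodge-generic points of a smooth projective family form a meagre set
# (Deligne 1972, Prop. 7.5; André 1992, §4 Lemma 4), from Griffiths' holomorphy of the Hodge bundles

Family `hodge`, layer `Literature/AlgebraicGeometry/HodgeTheory`; proof file (theorems only, no
definition, no named fact). Written by the prover seat `hodge-nonav-prover-Ax` (g11) of the cell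
`hodge-nonav` for route `HodgeConjecture/CyclicUnitaryPowers` (crux K1-A, stmt-HodgeConjecture-19544).

André 1992, §4 Lemma 4 (cf. Deligne, *La conjecture de Weil pour les surfaces K3*, Prop. 7.5): "On the
(pathwise connected) complement `X̊` of some meager subset of `X`, `G_x` is locally constant." In the
tree's vocabulary (`AlgebraicMonodromyMumfordTate`): the set of points `s ∈ S(ℂ)` which are NOT Hodge
generic (`IsHodgeGenericPoint`: every weight-`0` rational Hodge tensor of type `(0,0)` of `Hᵏ(X_s; ℚ)`
stays Hodge under every rational transport to every point) is MEAGRE. This is the ANALYTIC form of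
"very general points are Hodge generic"; its ALGEBRAIC form (the non-generic points lie in countably
many proper Zariski-closed subsets) is Cattani–Deligne–Kaplan 1995 (the tree's named fact
`cmsp_nonHodgeGenericPoints_countable_algebraic_cover`), which is NOT used here.

* `isHodgeGenericPoint_of_generic` — bookkeeping: a point `t₀` reached from a base point `s` by an
  admissible state `(δ₀, T₀)` at which every rational tensor that is Hodge for `T₀^* H_{t₀}` stays Hodge
  for every `T^* H_t` is a Hodge-generic point (`comapEquiv` along composites, `tensorSpace_comapEquiv`).
* `hodgeLociDichotomy_of_griffiths1968` — the local analytic dichotomy of Hodge loci (in a small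
  path-connected chart, the locus where a flat rational tensor is a weight-`0` Hodge tensor is all or
  nowhere dense) for ONE smooth projective family over a smooth quasi-projective base, from the named
  fact `Griffiths1968_holomorphicHodgeSubbundles` (Voisin I Thm. 10.3) via the tree theorems
  `exists_holomorphicFrame_of_subbundleFrames` and `hodgeLociDichotomy_of_holomorphicFrame` (the same
  two steps the unit `bku_finite_monodromyOrbit_of_isHodgeGenericIn` performs inline).
* `isMeagre_setOf_not_isHodgeGenericPoint_of_hodgeLociDichotomy` — from the dichotomy: the meagre
  form of Deligne's Baire argument (`isMeagre_nonGeneric_of_lociDichotomy`) at the countably many base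
  points of a countable dense subset of `S(ℂ)` (second countable: Serre), one of which lies in the
  (open) path component of any given point.
* `isMeagre_setOf_not_isHodgeGenericPoint_of_griffiths1968`, `exists_isMeagre_isHodgeGenericPoint_of_griffiths1968`
  — **the theorem**: granted Griffiths' theorem, the non-Hodge-generic points form a meagre subset of
  `S(ℂ)`; equivalently there is a meagre `M ⊆ S(ℂ)` off which every point is Hodge generic.

## References

* [Deligne1972WeilK3] P. Deligne, La conjecture de Weil pour les surfaces K3, Invent. Math. 15
  (1972), Prop. 7.5.
* [Andre1992] Y. André, Mumford–Tate groups of mixed Hodge structures and the theorem of the fixed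
  part, Compositio Math. 82 (1992), §4 Lemma 4 (p. 7).
* [VoisinHodgeI2002] C. Voisin, Hodge Theory and Complex Algebraic Geometry I, CUP 2002, §9.2.1,
  §10.2.1 Thm. 10.3.
* [Griffiths1968PeriodsII] P. Griffiths, Periods of integrals on algebraic manifolds II, Amer. J. Math.
  90 (1968), Thm. 1.1.
* [CarlsonMullerStachPeters2017] J. Carlson, S. Müller-Stach, C. Peters, Period Mappings and Period
  Domains, 2nd ed., CUP 2017, Def. 15.3.5.
-/

noncomputable section

open CategoryTheory AlgebraicGeometry
open _root_.Topology _root_.Filter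
open scoped TensorProduct
open Literature.AlgebraicTopology.SingularHomology
open Literature.AlgebraicGeometry.Motives

namespace Literature.AlgebraicGeometry.HodgeTheory

section HodgeTheory

/-! ### Transport along composites (private copy of `HodgeStructure.comapEquiv_trans`) -/

section Comap

variable {V W Y : Type} [AddCommGroup V] [Module ℚ V] [AddCommGroup W] [Module ℚ W]
  [AddCommGroup Y] [Module ℚ Y] {n₀ : ℤ}

/-- Transport of a Hodge structure is functorial: `(e₁ e₂)^* H = e₁^* (e₂^* H)` (a private copy of
`Motives.HodgeStructure.comapEquiv_trans` of `HodgeStructureAutGroupTransport`, to keep the import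
cone of this file small). [folklore] -/
private theorem comapEquiv_trans' (H : HodgeStructure Y n₀) (e₁ : V ≃ₗ[ℚ] W) (e₂ : W ≃ₗ[ℚ] Y) :
    H.comapEquiv (e₁.trans e₂) = (H.comapEquiv e₂).comapEquiv e₁ := by
  refine HodgeStructure.ext (funext fun p ↦ ?_)
  rw [HodgeStructure.comapEquiv_F, HodgeStructure.comapEquiv_F, HodgeStructure.comapEquiv_F,
    LinearEquiv.coe_trans, LinearMap.baseChange_comp, Submodule.comap_comp]

end Comap

/-! ### From a generic admissible state to a Hodge-generic point -/

section Family

variable {𝒳 S : SchemeOver ℂ} (f : 𝒳 ⟶ S) (k : ℕ) {U : Set (ComplexPoints S)}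
  (hU : IsCohomologicallyLocallyTrivialOn f U)
  [∀ t : ComplexPoints S, Module.Finite ℚ (singularCohomology ℚ ℚ (ComplexPoints (fiberOver f t)) k)]
  {n : ℕ} (hf : IsSmoothProjectiveFamily f n) [HodgeTensorFacts.{0, 0}]
  (A : ∀ t : ComplexPoints S, HodgeModel n (fiberOver f t)) (hA : ∀ t, (A t).IsHodgeSymmetric)

/-- **A generic admissible state sits over a Hodge-generic point.** If `t₀` is reached from the base
point `s` along `δ₀` with rational transport `T₀`, and every rational tensor `ζ ∈ T^{a,b} Hᵏ(X_s; ℚ)`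
which is a weight-`0` Hodge tensor of type `(0,0)` for `T₀^* H_{t₀}` is one for every `T^* H_t` (every
point `t`, path class `δ` from `s`, rational transport `T` along `δ`), then `t₀` is a Hodge-generic
point: a Hodge tensor `ζ'` of `H_{t₀}` is `ζ = (T^{a,b} T₀)⁻¹ ζ'` read through `T₀`
(`tensorSpace_comapEquiv`), and its transport along `δ'` by `T'` is read through `T₀ T'` along
`δ₀ δ'` (`comapEquiv` is functorial). [cite: CarlsonMullerStachPeters2017, Definition 15.3.5]
[cite: Deligne1972WeilK3, Prop. 7.5] -/
theorem isHodgeGenericPoint_of_generic {s t₀ : U} {δ₀ : Path.Homotopic.Quotient s t₀}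
    {T₀ : singularCohomology ℚ ℚ (ComplexPoints (fiberOver f s.1)) k ≃ₗ[ℚ]
      singularCohomology ℚ ℚ (ComplexPoints (fiberOver f t₀.1)) k}
    (hT₀ : IsRatTransport f k hU δ₀ T₀)
    (hgen : ∀ (a b : ℕ) (ζ : hodgeTensorSpace (singularCohomology ℚ ℚ (ComplexPoints (fiberOver f s.1)) k) a b),
      ζ ∈ ((((A t₀.1).hodgeStructure (hf.isSmoothProjective t₀.1) (hA t₀.1) k).comapEquiv T₀).tensorSpace
        a b).hodgeClasses 0 →
      ∀ (t : U) (δ : Path.Homotopic.Quotient s t)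
        (T : singularCohomology ℚ ℚ (ComplexPoints (fiberOver f s.1)) k ≃ₗ[ℚ]
          singularCohomology ℚ ℚ (ComplexPoints (fiberOver f t.1)) k),
        IsRatTransport f k hU δ T →
        ζ ∈ ((((A t.1).hodgeStructure (hf.isSmoothProjective t.1) (hA t.1) k).comapEquiv T).tensorSpace
          a b).hodgeClasses 0) :
    IsHodgeGenericPoint f k hU hf A hA t₀ := by
  intro a b _ ζ' hζ' t δ' T' hT'
  -- the tensor congruence `T^{a,b} T₀`
  let E := TensorProduct.congr (PiTensorProduct.congr fun _ : Fin a ↦ T₀)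
    (PiTensorProduct.congr fun _ : Fin b ↦ T₀.symm.dualMap)
  have h1 : E.symm ζ' ∈ ((((A t₀.1).hodgeStructure (hf.isSmoothProjective t₀.1) (hA t₀.1) k).comapEquiv
      T₀).tensorSpace a b).hodgeClasses 0 := by
    rw [HodgeStructure.tensorSpace_comapEquiv, HodgeStructure.comapEquiv_hodgeClasses,
      Submodule.mem_comap]
    change E (E.symm ζ') ∈ _
    rw [LinearEquiv.apply_symm_apply]
    exact hζ'
  have h2 := hgen a b (E.symm ζ') h1 t (δ₀.trans δ') (T₀.trans T') (hT₀.trans f k hU hT')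
  rw [comapEquiv_trans', HodgeStructure.tensorSpace_comapEquiv, HodgeStructure.comapEquiv_hodgeClasses,
    Submodule.mem_comap] at h2
  change E (E.symm ζ') ∈ _ at h2
  rwa [LinearEquiv.apply_symm_apply] at h2

end Family

/-! ### The dichotomy of Hodge loci for one family, from Griffiths' theorem -/

section Geometric

/-- **The analytic dichotomy of Hodge loci, from Griffiths' theorem** (Voisin I Thm. 10.3; CDK 1995 §1:
"the locus where a flat section remains of type `(p,p)` is a complex analytic subvariety"), for ONE
smooth projective family `f : 𝒳 ⟶ S` of relative dimension `n` over a smooth quasi-projective `S` of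
dimension `d`, Hodge-symmetric models `A t`, degree `k`, base point `s`: every point `t₁` of `S(ℂ)` has
arbitrarily small path-connected open neighbourhoods `W` such that, for every rational tensor
`ζ ∈ T^{a,b} Hᵏ(X_s; ℚ)`, every `x ∈ W` and every admissible state `Tx` at `x`, the locus of `t ∈ W` at
which `ζ` is a weight-`0` Hodge tensor of type `(0,0)` of `T^* H_t`, for the continuation `T` of `Tx`
along paths inside `W`, is all of `W` or nowhere dense. Proof: Griffiths' fact gives holomorphic
frames of each `F^p` along the continuations of a reference state at `t₁`;
`exists_holomorphicFrame_of_subbundleFrames` turns them into graded holomorphic frames for every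
admissible base state on a smaller `W`; `hodgeLociDichotomy_of_holomorphicFrame` (identity principle)
concludes. If `t₁` is not joined to `s` there is no admissible state near `t₁` and the condition is
void. [cite: VoisinHodgeI2002, §10.2.1 Thm. 10.3] [cite: Griffiths1968PeriodsII, Thm. 1.1]
[cite: Deligne1972WeilK3, Prop. 7.5] -/
theorem hodgeLociDichotomy_of_griffiths1968 (hG : Griffiths1968_holomorphicHodgeSubbundles)
    [HodgeTensorFacts.{0, 0}] {𝒳 S : SchemeOver ℂ} (f : 𝒳 ⟶ S) (n k d : ℕ)
    (hf : IsSmoothProjectiveFamily f n) (hS : IsQuasiProjectiveOver S)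
    [AlgebraicGeometry.SmoothOfRelativeDimension d S.hom]
    (hU : IsCohomologicallyLocallyTrivialOn f (Set.univ : Set (ComplexPoints S)))
    (A : ∀ t : ComplexPoints S, HodgeModel n (fiberOver f t)) (hA : ∀ t, (A t).IsHodgeSymmetric)
    [∀ t, Module.Finite ℚ (singularCohomology ℚ ℚ (ComplexPoints (fiberOver f t)) k)]
    (s t₁ : (Set.univ : Set (ComplexPoints S))) (N : Set (Set.univ : Set (ComplexPoints S)))
    (hN : N ∈ 𝓝 t₁) :
    ∃ W : Set (Set.univ : Set (ComplexPoints S)), IsOpen W ∧ t₁ ∈ W ∧ W ⊆ N ∧ IsPathConnected W ∧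
      ∀ (a b : ℕ) (ζ : hodgeTensorSpace (singularCohomology ℚ ℚ (ComplexPoints (fiberOver f
        (Subtype.val s))) k) a b) (x : (Set.univ : Set (ComplexPoints S))),
        x ∈ W → ∀ (Tx : singularCohomology ℚ ℚ (ComplexPoints (fiberOver f (Subtype.val s))) k ≃ₗ[ℚ]
          singularCohomology ℚ ℚ (ComplexPoints (fiberOver f (Subtype.val x))) k),
        (∃ δ : Path.Homotopic.Quotient s x,
          ∀ v, ofRatClass _ k (Tx v) = transportFun f k hU δ (ofRatClass _ k v)) →
        (∀ t ∈ W, ∀ (ε : Path x t), (∀ r, ε r ∈ W) → ∀ (T : singularCohomology ℚ ℚ (ComplexPoints (fiberOver f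
          (Subtype.val s))) k ≃ₗ[ℚ]
          singularCohomology ℚ ℚ (ComplexPoints (fiberOver f (Subtype.val t))) k),
          (∀ v, ofRatClass _ k (T v) = transportFun f k hU ⟦ε⟧ (ofRatClass _ k (Tx v))) →
          ζ ∈ ((((A t.1).hodgeStructure (hf.isSmoothProjective t.1) (hA t.1) k).comapEquiv T).tensorSpace
            a b).hodgeClasses 0) ∨
        IsNowhereDense {t : (Set.univ : Set (ComplexPoints S)) | t ∈ W ∧ ∀ (ε : Path x t),
          (∀ r, ε r ∈ W) → ∀ (T : singularCohomology ℚ ℚ (ComplexPoints (fiberOver f (Subtype.val s))) k ≃ₗ[ℚ]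
            singularCohomology ℚ ℚ (ComplexPoints (fiberOver f (Subtype.val t))) k),
          (∀ v, ofRatClass _ k (T v) = transportFun f k hU ⟦ε⟧ (ofRatClass _ k (Tx v))) →
          ζ ∈ ((((A t.1).hodgeStructure (hf.isSmoothProjective t.1) (hA t.1) k).comapEquiv T).tensorSpace
            a b).hodgeClasses 0} := by
  obtain ⟨W₀, hW₀o, ht₁W₀, hW₀N, hW₀pc, ψ, hW₀ψ, hfr⟩ := hG f n k d hf hS hU A hA s t₁ N hN
  -- topology of `S(ℂ)`: a manifold, hence locally path connected
  haveI : AlgebraicGeometry.LocallyOfFiniteType S.hom := hS.locallyOfFiniteType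
  haveI : AlgebraicGeometry.IsSeparated S.hom := hS.isVarietyPair_ofScheme.isSeparated
  haveI : T2Space (ComplexPoints S) := Literature.NumberTheory.Transcendental.t2Space_algPoints_holds _ ℂ
  letI := Motives.ComplexPoints.chartedSpace S d
  haveI : LocallyPathConnectedSpace (ComplexPoints S) :=
    ChartedSpace.locallyPathConnectedSpace (EuclideanSpace ℝ (Fin (2 * d))) _
  haveI : LocallyPathConnectedSpace (Set.univ : Set (ComplexPoints S)) :=
    isOpen_univ.locallyPathConnectedSpace
  have hrat : ∀ (x y : (Set.univ : Set (ComplexPoints S))) (γ : Path.Homotopic.Quotient x y)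
      (α : complexBetti (fiberOver f x.1) k), IsRationalClass α →
      IsRationalClass (transportFun f k hU γ α) :=
    fun x y γ α hα ↦ isRationalClass_transportFun_of_isSmoothProjectiveFamily f k d hf hS γ hα
  by_cases hjs : Joined s t₁
  · -- an admissible reference state at `t₁` exists: graded frames on a smaller `W`, then the dichotomy
    obtain ⟨T₁, hT₁⟩ := exists_ratTransport f k hU hrat (⟦hjs.somePath⟧ : Path.Homotopic.Quotient s t₁)
    have hT₁' : ∃ δ₁ : Path.Homotopic.Quotient s t₁,
        ∀ v, ofRatClass _ k (T₁ v) = transportFun f k hU δ₁ (ofRatClass _ k v) := ⟨_, hT₁⟩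
    choose r w hw hwhol using hfr T₁ hT₁'
    obtain ⟨W, hWo, ht₁W, hWW₀, hWpc, hW⟩ := exists_holomorphicFrame_of_subbundleFrames f k hU s hrat
      (fun t ↦ (A t.1).hodgeStructure (hf.isSmoothProjective t.1) (hA t.1) k) hW₀o hW₀pc ψ hW₀ψ
      ht₁W₀ hT₁' r w hw hwhol
    refine ⟨W, hWo, ht₁W, hWW₀.trans hW₀N, hWpc, fun a b ζ x hx Tx hTx ↦ ?_⟩
    obtain ⟨N', deg, e, hF, hol₁, hol₂⟩ := hW x hx Tx hTx
    exact hodgeLociDichotomy_of_holomorphicFrame f k hU s hrat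
      (fun t ↦ (A t.1).hodgeStructure (hf.isSmoothProjective t.1) (hA t.1) k) hWo hWpc ψ
      (hWW₀.trans hW₀ψ) hx hTx e hF hol₁ hol₂ a b ζ
  · -- no admissible state near `t₁`: the condition is void on `W₀`
    refine ⟨W₀, hW₀o, ht₁W₀, hW₀N, hW₀pc, fun a b ζ x hx Tx hTx ↦ ?_⟩
    exfalso
    obtain ⟨δ, -⟩ := hTx
    induction δ using Quotient.inductionOn with
    | h γ => exact hjs (Joined.trans ⟨γ⟩ (hW₀pc.joinedIn x hx t₁ ht₁W₀).joined)

/-- **The non-Hodge-generic points form a meagre set — from the analytic dichotomy of Hodge loci**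
(Deligne 1972, Prop. 7.5; André 1992, §4 Lemma 4: "the complement `X̊` of some meager subset"). For a
smooth projective family `f : 𝒳 ⟶ S` of relative dimension `n` over a smooth quasi-projective `S` of
dimension `d`, cohomologically locally trivial, Hodge-symmetric models `A t`, a degree `k`, and the
dichotomy `hD` at every base point: the set of points of `S(ℂ)` which are not Hodge generic
(`IsHodgeGenericPoint`) is meagre. Proof: `S(ℂ)` is a second countable topological manifold (Serre,
GAGA §2), so it has a countable dense subset `D` and open path components; the meagre form of
Deligne's Baire argument (`isMeagre_nonGeneric_of_lociDichotomy`) at each base point `x ∈ D` gives a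
meagre `M_x` off which every admissible state from `x` is generic; a point `t₀` off `⋃_{x ∈ D} M_x` has
some `x ∈ D` in its path component, hence an admissible state from `x`, hence is Hodge generic
(`isHodgeGenericPoint_of_generic`). [cite: Deligne1972WeilK3, Prop. 7.5] [cite: Andre1992, §4 Lemma 4]
[cite: CarlsonMullerStachPeters2017, Definition 15.3.5] -/
theorem isMeagre_setOf_not_isHodgeGenericPoint_of_hodgeLociDichotomy
    [HodgeTensorFacts.{0, 0}] {𝒳 S : SchemeOver ℂ} (f : 𝒳 ⟶ S) (n k d : ℕ)
    (hf : IsSmoothProjectiveFamily f n) (hS : IsQuasiProjectiveOver S)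
    [AlgebraicGeometry.SmoothOfRelativeDimension d S.hom]
    (hU : IsCohomologicallyLocallyTrivialOn f (Set.univ : Set (ComplexPoints S)))
    (A : ∀ t : ComplexPoints S, HodgeModel n (fiberOver f t)) (hA : ∀ t, (A t).IsHodgeSymmetric)
    [∀ t, Module.Finite ℚ (singularCohomology ℚ ℚ (ComplexPoints (fiberOver f t)) k)]
    (hD : ∀ (s t₁ : (Set.univ : Set (ComplexPoints S))), ∀ N ∈ 𝓝 t₁,
      ∃ W : Set (Set.univ : Set (ComplexPoints S)), IsOpen W ∧ t₁ ∈ W ∧ W ⊆ N ∧ IsPathConnected W ∧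
      ∀ (a b : ℕ) (ζ : hodgeTensorSpace (singularCohomology ℚ ℚ (ComplexPoints (fiberOver f
        (Subtype.val s))) k) a b) (x : (Set.univ : Set (ComplexPoints S))),
        x ∈ W → ∀ (Tx : singularCohomology ℚ ℚ (ComplexPoints (fiberOver f (Subtype.val s))) k ≃ₗ[ℚ]
          singularCohomology ℚ ℚ (ComplexPoints (fiberOver f (Subtype.val x))) k),
        (∃ δ : Path.Homotopic.Quotient s x,
          ∀ v, ofRatClass _ k (Tx v) = transportFun f k hU δ (ofRatClass _ k v)) →
        (∀ t ∈ W, ∀ (ε : Path x t), (∀ r, ε r ∈ W) → ∀ (T : singularCohomology ℚ ℚ (ComplexPoints (fiberOver f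
          (Subtype.val s))) k ≃ₗ[ℚ]
          singularCohomology ℚ ℚ (ComplexPoints (fiberOver f (Subtype.val t))) k),
          (∀ v, ofRatClass _ k (T v) = transportFun f k hU ⟦ε⟧ (ofRatClass _ k (Tx v))) →
          ζ ∈ ((((A t.1).hodgeStructure (hf.isSmoothProjective t.1) (hA t.1) k).comapEquiv T).tensorSpace
            a b).hodgeClasses 0) ∨
        IsNowhereDense {t : (Set.univ : Set (ComplexPoints S)) | t ∈ W ∧ ∀ (ε : Path x t),
          (∀ r, ε r ∈ W) → ∀ (T : singularCohomology ℚ ℚ (ComplexPoints (fiberOver f (Subtype.val s))) k ≃ₗ[ℚ]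
            singularCohomology ℚ ℚ (ComplexPoints (fiberOver f (Subtype.val t))) k),
          (∀ v, ofRatClass _ k (T v) = transportFun f k hU ⟦ε⟧ (ofRatClass _ k (Tx v))) →
          ζ ∈ ((((A t.1).hodgeStructure (hf.isSmoothProjective t.1) (hA t.1) k).comapEquiv T).tensorSpace
            a b).hodgeClasses 0}) :
    IsMeagre {t : (Set.univ : Set (ComplexPoints S)) | ¬ IsHodgeGenericPoint f k hU hf A hA t} := by
  classical
  -- topology of `S(ℂ)`: a second countable topological manifold
  haveI : AlgebraicGeometry.LocallyOfFiniteType S.hom := hS.locallyOfFiniteType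
  haveI : AlgebraicGeometry.IsSeparated S.hom := hS.isVarietyPair_ofScheme.isSeparated
  haveI : AlgebraicGeometry.QuasiCompact S.hom := hS.isVarietyPair_ofScheme.quasiCompact
  haveI : CompactSpace S.left := QuasiCompact.compactSpace_of_compactSpace S.hom
  haveI : T2Space (ComplexPoints S) := Literature.NumberTheory.Transcendental.t2Space_algPoints_holds _ ℂ
  letI := Motives.ComplexPoints.chartedSpace S d
  haveI : LocallyPathConnectedSpace (ComplexPoints S) :=
    ChartedSpace.locallyPathConnectedSpace (EuclideanSpace ℝ (Fin (2 * d))) _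
  haveI : SecondCountableTopology (ComplexPoints S) :=
    Motives.ComplexPoints.secondCountableTopology_of_compactSpace_holds _
  haveI : LocallyPathConnectedSpace (Set.univ : Set (ComplexPoints S)) :=
    isOpen_univ.locallyPathConnectedSpace
  haveI : ∀ (x : (Set.univ : Set (ComplexPoints S))) (a b : ℕ), Countable (hodgeTensorSpace
      (singularCohomology ℚ ℚ (ComplexPoints (fiberOver f x.1)) k) a b) :=
    fun x a b ↦ by
      haveI : Module.Finite ℚ (hodgeTensorSpace
          (singularCohomology ℚ ℚ (ComplexPoints (fiberOver f x.1)) k) a b) :=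
        Module.Finite.of_basis (hodgeTensorBasis (Module.finBasis ℚ _) a b)
      exact countable_of_module_finite_rat _
  have hrat : ∀ (x y : (Set.univ : Set (ComplexPoints S))) (γ : Path.Homotopic.Quotient x y)
      (α : complexBetti (fiberOver f x.1) k), IsRationalClass α →
      IsRationalClass (transportFun f k hU γ α) :=
    fun x y γ α hα ↦ isRationalClass_transportFun_of_isSmoothProjectiveFamily f k d hf hS γ hα
  -- the meagre set attached to a base point `x`
  have hM : ∀ x : (Set.univ : Set (ComplexPoints S)), ∃ M : Set (Set.univ : Set (ComplexPoints S)),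
      IsMeagre M ∧ ∀ t₀ ∉ M, ∀ (δ₀ : Path.Homotopic.Quotient x t₀)
        (T₀ : singularCohomology ℚ ℚ (ComplexPoints (fiberOver f (Subtype.val x))) k ≃ₗ[ℚ]
          singularCohomology ℚ ℚ (ComplexPoints (fiberOver f (Subtype.val t₀))) k),
        (∀ v, ofRatClass _ k (T₀ v) = transportFun f k hU δ₀ (ofRatClass _ k v)) →
        ∀ q : (Σ a b : ℕ, hodgeTensorSpace (singularCohomology ℚ ℚ (ComplexPoints (fiberOver f x.1)) k) a b),
          q.2.2 ∈ ((((A t₀.1).hodgeStructure (hf.isSmoothProjective t₀.1) (hA t₀.1) k).comapEquiv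
            T₀).tensorSpace q.1 q.2.1).hodgeClasses 0 →
          ∀ (t : (Set.univ : Set (ComplexPoints S))) (δ : Path.Homotopic.Quotient x t)
            (T : singularCohomology ℚ ℚ (ComplexPoints (fiberOver f (Subtype.val x))) k ≃ₗ[ℚ]
              singularCohomology ℚ ℚ (ComplexPoints (fiberOver f (Subtype.val t))) k),
            (∀ v, ofRatClass _ k (T v) = transportFun f k hU δ (ofRatClass _ k v)) →
            q.2.2 ∈ ((((A t.1).hodgeStructure (hf.isSmoothProjective t.1) (hA t.1) k).comapEquiv
              T).tensorSpace q.1 q.2.1).hodgeClasses 0 := by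
    intro x
    exact isMeagre_nonGeneric_of_lociDichotomy f k hU x hrat
      (ι := Σ a b : ℕ, hodgeTensorSpace (singularCohomology ℚ ℚ (ComplexPoints (fiberOver f x.1)) k) a b)
      (fun q t T ↦ q.2.2 ∈ ((((A t.1).hodgeStructure (hf.isSmoothProjective t.1) (hA t.1) k).comapEquiv
        T).tensorSpace q.1 q.2.1).hodgeClasses 0)
      (fun t₁ N hN ↦ by
        obtain ⟨W, hWo, ht₁W, hWN, hWpc, hW⟩ := hD x t₁ N hN
        exact ⟨W, hWo, ht₁W, hWN, hWpc, fun q y hy Ty hTy ↦ hW q.1 q.2.1 q.2.2 y hy Ty hTy⟩)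
  choose M hMm hMg using hM
  -- a countable dense set of base points
  obtain ⟨D, hDc, hDd⟩ := TopologicalSpace.exists_countable_dense (Set.univ : Set (ComplexPoints S))
  refine (isMeagre_biUnion hDc (f := M) fun x _ ↦ hMm x).mono ?_
  intro t₀ ht₀
  rw [Set.mem_setOf_eq] at ht₀
  by_contra hnot
  apply ht₀
  -- a base point of `D` in the (open) path component of `t₀`
  obtain ⟨x, hxD, hxP⟩ := hDd.exists_mem_open (IsOpen.pathComponent t₀) ⟨t₀, mem_pathComponent_self t₀⟩
  have hj : Joined x t₀ := Joined.symm hxP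
  obtain ⟨T₀, hT₀⟩ := exists_ratTransport f k hU hrat (⟦hj.somePath⟧ : Path.Homotopic.Quotient x t₀)
  have ht₀M : t₀ ∉ M x := fun h ↦ hnot (Set.mem_biUnion hxD h)
  exact isHodgeGenericPoint_of_generic f k hU hf A hA hT₀ fun a b ζ hζ t δ T hT ↦
    hMg x t₀ ht₀M _ T₀ hT₀ ⟨a, b, ζ⟩ hζ t δ T hT

/-- **The non-Hodge-generic points of a smooth projective family over a smooth quasi-projective base
form a meagre set, granted Griffiths' theorem** (Deligne 1972, Prop. 7.5; André 1992, §4 Lemma 4; the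
analytic input is the named fact `Griffiths1968_holomorphicHodgeSubbundles`, Voisin I Thm. 10.3).
[cite: Deligne1972WeilK3, Prop. 7.5] [cite: Andre1992, §4 Lemma 4] [cite: VoisinHodgeI2002, §10.2.1 Thm. 10.3] -/
theorem isMeagre_setOf_not_isHodgeGenericPoint_of_griffiths1968 (hG : Griffiths1968_holomorphicHodgeSubbundles)
    [HodgeTensorFacts.{0, 0}] {𝒳 S : SchemeOver ℂ} (f : 𝒳 ⟶ S) (n k d : ℕ)
    (hf : IsSmoothProjectiveFamily f n) (hS : IsQuasiProjectiveOver S)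
    [AlgebraicGeometry.SmoothOfRelativeDimension d S.hom]
    (hU : IsCohomologicallyLocallyTrivialOn f (Set.univ : Set (ComplexPoints S)))
    (A : ∀ t : ComplexPoints S, HodgeModel n (fiberOver f t)) (hA : ∀ t, (A t).IsHodgeSymmetric)
    [∀ t, Module.Finite ℚ (singularCohomology ℚ ℚ (ComplexPoints (fiberOver f t)) k)] :
    IsMeagre {t : (Set.univ : Set (ComplexPoints S)) | ¬ IsHodgeGenericPoint f k hU hf A hA t} :=
  isMeagre_setOf_not_isHodgeGenericPoint_of_hodgeLociDichotomy f n k d hf hS hU A hA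
    fun s t₁ N hN ↦ hodgeLociDichotomy_of_griffiths1968 hG f n k d hf hS hU A hA s t₁ N hN

/-- **Consumer form**: granted Griffiths' theorem, there is a MEAGRE subset `M ⊆ S(ℂ)` such that every
point off `M` is Hodge generic — "very general points (complement of a meagre set) are Hodge generic",
the analytic counterpart of the Cattani–Deligne–Kaplan cover
`cmsp_nonHodgeGenericPoints_countable_algebraic_cover`. [cite: Deligne1972WeilK3, Prop. 7.5]
[cite: Andre1992, §4 Lemma 4] [cite: VoisinHodgeI2002, §10.2.1 Thm. 10.3] -/
theorem exists_isMeagre_isHodgeGenericPoint_of_griffiths1968 (hG : Griffiths1968_holomorphicHodgeSubbundles)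
    [HodgeTensorFacts.{0, 0}] {𝒳 S : SchemeOver ℂ} (f : 𝒳 ⟶ S) (n k d : ℕ)
    (hf : IsSmoothProjectiveFamily f n) (hS : IsQuasiProjectiveOver S)
    [AlgebraicGeometry.SmoothOfRelativeDimension d S.hom]
    (hU : IsCohomologicallyLocallyTrivialOn f (Set.univ : Set (ComplexPoints S)))
    (A : ∀ t : ComplexPoints S, HodgeModel n (fiberOver f t)) (hA : ∀ t, (A t).IsHodgeSymmetric)
    [∀ t, Module.Finite ℚ (singularCohomology ℚ ℚ (ComplexPoints (fiberOver f t)) k)] :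
    ∃ M : Set (ComplexPoints S), IsMeagre M ∧
      ∀ s : (Set.univ : Set (ComplexPoints S)), s.1 ∉ M → IsHodgeGenericPoint f k hU hf A hA s := by
  refine ⟨Subtype.val '' {t : (Set.univ : Set (ComplexPoints S)) | ¬ IsHodgeGenericPoint f k hU hf A hA t},
    (isMeagre_setOf_not_isHodgeGenericPoint_of_griffiths1968 hG f n k d hf hS hU A hA).image_val, ?_⟩
  intro s hs
  by_contra h
  exact hs ⟨s, h, rfl⟩

end Geometric

end HodgeTheory

end Literature.AlgebraicGeometry.HodgeTheory

end
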